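import Summits.Ventures.LatticeQCDFlow.Exactness.Phi4MetropolisTauIntFloor
import Summits.Ventures.LatticeQCDFlow.Exactness.ReversibleLocalityFloor
import Mathlib.Algebra.Order.Chebyshev
import HarnessLib

/-!
# The RANDOM-SITE-SCAN local Metropolis sampler of lattice φ⁴: a reversible Markov contraction with bounded moves

HONEST FRAMING: exact (Metropolis-corrected) sampling algorithms for lattice gauge theory;
figures of merit are autocorrelation/cost numbers at stated couplings and volumes; no
continuum-physics claim.  (SCALAR calibration rung S0-A: not a gauge result.)

Venture `LatticeQCDFlow` (cell pub-lqcd), topic `Exactness`; FANOUT row 2 (`s0-phi4`, LOCAL arm).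
NEW WORK of the cell, composing row 2's single-site hit `metroSite J λ ρ x`
(`Phi4LocalMetropolisExact` / `…Reversible` / `Phi4MetropolisTauIntFloor`: exact, reversible, linear,
`L²`-contracting) into the reversible form of the local sampler — the RANDOM-SITE SCAN
`K = (1/V) Σ_x M_x` (`V = n+1` sites) — and verifying for it every hypothesis of the abstract
locality floor `Exactness/ReversibleLocalityFloor.lean` on the class of bounded measurable
observables.  Nothing is cited as a fact.  (The engine's lexicographic SWEEP is the ordered product
`M_V ∘ ⋯ ∘ M_1`, exact but not reversible; the random scan is its reversible textbook form, same cost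
per site update — Metropolis et al. 1953, Hastings 1970, named only.)

## What is proved (`Λ = Fin (n+1)`, `w = e^{−S}`, coercive action, even step density `ρ`)

* `BddObs` — the admissible class "measurable and bounded" with its closure lemmas
  (`bddObs_const`, `bddObs_add_mul`, `bddObs_sq`, `bddObs_integrable_mul_mul_gibbsWeight`,
  `bddObs_metroSite`);
* `metroScan J λ ρ` — the random-site-scan operator; `bddObs_metroScan` (stability),
  `metroScan_add_mul` (linearity), `metroScan_one` (`K1 = 1`), `integral_metroScan_mul_mul`,
  **`metroScan_reversible`** (`∫ (Kf) g e^{−S} = ∫ f (Kg) e^{−S}`), **`metroScan_contraction`**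
  (`∫ (Kf)² e^{−S} ≤ ∫ f² e^{−S}`, Jensen over sites + `metroSite_contraction`);
* **`metroSite_sq_dev_le`**, **`metroScan_sq_dev_le`** — BOUNDED MOVES: if every proposal the step
  law can make changes `g` by at most `√D` (`ρ(t' − φ_x) ≠ 0 ⇒ (g(φ|φ_x:=t') − g(φ))² ≤ D`), then the
  carré du champ `K[(g − g(φ))²](φ) ≤ D` at every configuration.

These are exactly the inputs of `RevOp.thinned_tauInt_ge_of_carre_le`; the critical-slowing-down
floor itself is drawn in `Exactness/Phi4MetropolisCSDFloor.lean`.  NOT CLAIMED: anything about the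
ordered sweep; irreducibility; any acceptance number.
-/

namespace Summit.Ventures.LatticeQCDFlow.Exactness

open Real MeasureTheory Filter Finset
open Summit.Ventures.LatticeQCDFlow.Scoring

section Scan

variable {n : ℕ}

/-- The admissible class of BOUNDED MEASURABLE observables on `ℝ^Λ` (measurable, and `|f| ≤ B`
for some `B`); used as the predicate `A` of the abstract `RevOp` files.  A standard notion, no single
source. [folklore] -/
@[folklore]
def BddObs (f : (Fin (n + 1) → ℝ) → ℝ) : Prop :=
  Measurable f ∧ ∃ B : ℝ, ∀ φ, |f φ| ≤ B

/-- **The random-site-scan local Metropolis operator** of lattice φ⁴: choose a site uniformly among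
the `n+1` sites and apply the single-site Metropolis hit there; as an operator on observables,
`(K f)(φ) = (1/(n+1)) Σ_x (M_x f)(φ)`. -/
noncomputable def metroScan (J : Fin (n + 1) → Fin (n + 1) → ℝ) (lam : ℝ) (ρ : ℝ → ℝ)
    (f : (Fin (n + 1) → ℝ) → ℝ) (φ : Fin (n + 1) → ℝ) : ℝ :=
  (∑ x, metroSite J lam ρ x f φ) / ((n : ℝ) + 1)

/-- Constants are bounded observables. -/
theorem bddObs_const (c : ℝ) : BddObs (fun _ : Fin (n + 1) → ℝ => c) :=
  ⟨measurable_const, |c|, fun _ => le_rfl⟩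

/-- The class is closed under `f + c h`. -/
theorem bddObs_add_mul {f h : (Fin (n + 1) → ℝ) → ℝ} (hf : BddObs f) (hh : BddObs h) (c : ℝ) :
    BddObs (fun φ => f φ + c * h φ) := by
  obtain ⟨hfm, Bf, hfb⟩ := hf
  obtain ⟨hhm, Bh, hhb⟩ := hh
  refine ⟨hfm.add (measurable_const.mul hhm), Bf + |c| * Bh, fun φ => ?_⟩
  calc |f φ + c * h φ| ≤ |f φ| + |c * h φ| := abs_add_le _ _
    _ ≤ Bf + |c| * Bh := by
        rw [abs_mul]
        exact add_le_add (hfb φ) (mul_le_mul_of_nonneg_left (hhb φ) (abs_nonneg c))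

/-- The class is closed under squaring. -/
theorem bddObs_sq {f : (Fin (n + 1) → ℝ) → ℝ} (hf : BddObs f) : BddObs (fun φ => f φ ^ 2) := by
  obtain ⟨hfm, B, hfb⟩ := hf
  refine ⟨hfm.pow_const 2, B ^ 2, fun φ => ?_⟩
  rw [abs_pow]
  exact pow_le_pow_left₀ (abs_nonneg _) (hfb φ) 2

/-- Products of two bounded observables are integrable against `e^{−S}` (coercive action). -/
theorem bddObs_integrable_mul_mul_gibbsWeight {J : Fin (n + 1) → Fin (n + 1) → ℝ} {lam ε K : ℝ}
    (hε : 0 < ε) (hS : ∀ φ : Fin (n + 1) → ℝ, ε * ∑ w, φ w ^ 2 - K ≤ latticePhi4Action J lam φ)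
    {f h : (Fin (n + 1) → ℝ) → ℝ} (hf : BddObs f) (hh : BddObs h) :
    Integrable (fun φ => f φ * h φ * gibbsWeight J lam φ) := by
  obtain ⟨hfm, Bf, hfb⟩ := hf
  obtain ⟨hhm, Bh, hhb⟩ := hh
  have hfh : ∀ φ, |f φ * h φ| ≤ Bf * Bh := fun φ => by
    rw [abs_mul]
    exact mul_le_mul (hfb φ) (hhb φ) (abs_nonneg _) ((abs_nonneg _).trans (hfb φ))
  exact integrable_bdd_mul_weight (μ := volume) (hfm.mul hhm) hfh
    (continuous_gibbsWeight J lam).measurable (fun φ => (gibbsWeight_pos J lam φ).le)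
    (integrable_gibbsWeight_of_coercive hε hS)

/-- The single-site hit maps the class to itself (row 2's `measurable_metroSite`, `abs_metroSite_le`). -/
theorem bddObs_metroSite (J : Fin (n + 1) → Fin (n + 1) → ℝ) (lam : ℝ) {ρ : ℝ → ℝ}
    (hρ0 : ∀ u, 0 ≤ ρ u) (hρm : Measurable ρ) (hρi : Integrable ρ) (hρ1 : ∫ u, ρ u = 1)
    (x : Fin (n + 1)) {f : (Fin (n + 1) → ℝ) → ℝ} (hf : BddObs f) :
    BddObs (metroSite J lam ρ x f) :=
  ⟨(measurable_metroSite J lam hρm x hf.1).measurable,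
    hf.2.imp fun _ hB φ => abs_metroSite_le J lam hρ0 hρi hρ1 x hB φ⟩

/-- **The scan maps the class to itself.** -/
theorem bddObs_metroScan (J : Fin (n + 1) → Fin (n + 1) → ℝ) (lam : ℝ) {ρ : ℝ → ℝ}
    (hρ0 : ∀ u, 0 ≤ ρ u) (hρm : Measurable ρ) (hρi : Integrable ρ) (hρ1 : ∫ u, ρ u = 1)
    {f : (Fin (n + 1) → ℝ) → ℝ} (hf : BddObs f) : BddObs (metroScan J lam ρ f) := by
  obtain ⟨hfm, B, hfb⟩ := hf
  have hn : (0 : ℝ) < (n : ℝ) + 1 := by positivity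
  refine ⟨?_, B, fun φ => ?_⟩
  · unfold metroScan
    exact (Finset.measurable_sum _ fun x _ =>
      (measurable_metroSite J lam hρm x hfm).measurable).div_const _
  · unfold metroScan
    rw [abs_div, abs_of_pos hn, div_le_iff₀ hn]
    calc |∑ x, metroSite J lam ρ x f φ| ≤ ∑ x, |metroSite J lam ρ x f φ| :=
          Finset.abs_sum_le_sum_abs _ _
      _ ≤ ∑ _x : Fin (n + 1), B :=
          Finset.sum_le_sum fun x _ => abs_metroSite_le J lam hρ0 hρi hρ1 x hfb φ
      _ = B * ((n : ℝ) + 1) := by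
          rw [Finset.sum_const, Finset.card_univ, Fintype.card_fin, nsmul_eq_mul]
          push_cast
          ring

/-- **The scan is linear** on bounded observables. -/
theorem metroScan_add_mul (J : Fin (n + 1) → Fin (n + 1) → ℝ) (lam : ℝ) {ρ : ℝ → ℝ}
    (hρ0 : ∀ u, 0 ≤ ρ u) (hρm : Measurable ρ) (hρi : Integrable ρ)
    {f h : (Fin (n + 1) → ℝ) → ℝ} (hf : BddObs f) (hh : BddObs h) (c : ℝ) (φ : Fin (n + 1) → ℝ) :
    metroScan J lam ρ (fun s => f s + c * h s) φ = metroScan J lam ρ f φ + c * metroScan J lam ρ h φ := by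
  obtain ⟨hfm, Bf, hfb⟩ := hf
  obtain ⟨hhm, Bh, hhb⟩ := hh
  unfold metroScan
  rw [Finset.sum_congr rfl fun x _ => metroSite_add_mul J lam hρ0 hρm hρi x hfm hhm hfb hhb c φ,
    Finset.sum_add_distrib, ← Finset.mul_sum, add_div, mul_div_assoc]

/-- **`K 1 = 1`**: the scan is a Markov operator (`ρ` a probability density). -/
theorem metroScan_one (J : Fin (n + 1) → Fin (n + 1) → ℝ) (lam : ℝ) {ρ : ℝ → ℝ}
    (hρ1 : ∫ u, ρ u = 1) (φ : Fin (n + 1) → ℝ) :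
    metroScan J lam ρ (fun _ => (1 : ℝ)) φ = 1 := by
  have hn : (0 : ℝ) < (n : ℝ) + 1 := by positivity
  have h1 : ∀ x, metroSite J lam ρ x (fun _ => (1 : ℝ)) φ = 1 := by
    intro x
    unfold metroSite
    have e : ∀ t', (metroAccept J lam x φ t' * 1 + (1 - metroAccept J lam x φ t') * 1) * ρ (t' - φ x)
        = ρ (t' - φ x) := fun t' => by ring
    simp_rw [e]
    rw [integral_sub_right_eq_self (μ := (volume : Measure ℝ)) ρ (φ x), hρ1]
  unfold metroScan
  simp_rw [h1]
  rw [Finset.sum_const, Finset.card_univ, Fintype.card_fin, nsmul_eq_mul, mul_one]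
  push_cast
  exact div_self hn.ne'

/-- The scan form under the integral: `∫ (Kf) g w = (1/V) Σ_x ∫ (M_x f) g w`. -/
theorem integral_metroScan_mul_mul {J : Fin (n + 1) → Fin (n + 1) → ℝ} {lam ε K : ℝ}
    (hε : 0 < ε) (hS : ∀ φ : Fin (n + 1) → ℝ, ε * ∑ w, φ w ^ 2 - K ≤ latticePhi4Action J lam φ)
    {ρ : ℝ → ℝ} (hρ0 : ∀ u, 0 ≤ ρ u) (hρm : Measurable ρ) (hρi : Integrable ρ)
    (hρ1 : ∫ u, ρ u = 1) {f g : (Fin (n + 1) → ℝ) → ℝ} (hf : BddObs f) (hg : BddObs g) :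
    ∫ φ, metroScan J lam ρ f φ * g φ * gibbsWeight J lam φ
      = (∑ x, ∫ φ, metroSite J lam ρ x f φ * g φ * gibbsWeight J lam φ) / ((n : ℝ) + 1) := by
  unfold metroScan
  have e : ∀ φ, (∑ x, metroSite J lam ρ x f φ) / ((n : ℝ) + 1) * g φ * gibbsWeight J lam φ
      = (∑ x, metroSite J lam ρ x f φ * g φ * gibbsWeight J lam φ) / ((n : ℝ) + 1) := by
    intro φ
    rw [Finset.sum_div, Finset.sum_div, Finset.sum_mul, Finset.sum_mul]
    exact Finset.sum_congr rfl fun x _ => by ring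
  simp_rw [e]
  rw [integral_div, integral_finsetSum _ fun x _ =>
    bddObs_integrable_mul_mul_gibbsWeight hε hS (bddObs_metroSite J lam hρ0 hρm hρi hρ1 x hf) hg]

/-- **THE RANDOM-SITE SCAN IS REVERSIBLE** (`∫ (Kf) g e^{−S} = ∫ f (Kg) e^{−S}` for bounded
measurable `f, g`): the average of row 2's reversible hits. -/
theorem metroScan_reversible {J : Fin (n + 1) → Fin (n + 1) → ℝ} {lam ε K : ℝ} (hε : 0 < ε)
    (hS : ∀ φ : Fin (n + 1) → ℝ, ε * ∑ w, φ w ^ 2 - K ≤ latticePhi4Action J lam φ)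
    {ρ : ℝ → ℝ} (hρ0 : ∀ u, 0 ≤ ρ u) (hρm : Measurable ρ) (hρi : Integrable ρ)
    (hρ1 : ∫ u, ρ u = 1) (hρs : ∀ u, ρ (-u) = ρ u) {f g : (Fin (n + 1) → ℝ) → ℝ}
    (hf : BddObs f) (hg : BddObs g) :
    ∫ φ, metroScan J lam ρ f φ * g φ * gibbsWeight J lam φ
      = ∫ φ, f φ * metroScan J lam ρ g φ * gibbsWeight J lam φ := by
  rw [integral_metroScan_mul_mul hε hS hρ0 hρm hρi hρ1 hf hg]
  -- the right-hand side in scan form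
  have e : ∀ φ, f φ * metroScan J lam ρ g φ * gibbsWeight J lam φ
      = (∑ x, f φ * metroSite J lam ρ x g φ * gibbsWeight J lam φ) / ((n : ℝ) + 1) := by
    intro φ
    unfold metroScan
    rw [Finset.sum_div, Finset.mul_sum, Finset.sum_mul, Finset.sum_div]
    exact Finset.sum_congr rfl fun x _ => by ring
  simp_rw [e]
  have hint : ∀ x, Integrable (fun φ => f φ * metroSite J lam ρ x g φ * gibbsWeight J lam φ) := by
    intro x
    have := bddObs_integrable_mul_mul_gibbsWeight hε hS hf (bddObs_metroSite J lam hρ0 hρm hρi hρ1 x hg)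
    exact this
  rw [integral_div, integral_finsetSum _ fun x _ => hint x]
  congr 1
  refine Finset.sum_congr rfl fun x _ => ?_
  obtain ⟨hfm, Bf, hfb⟩ := hf
  obtain ⟨hgm, Bg, hgb⟩ := hg
  exact metropolis_site_reversible hε hS x hρ0 hρm hρi hρ1 hρs hfm hgm hfb hgb

/-- Jensen over the sites: `((1/V) Σ_x a_x)² ≤ (1/V) Σ_x a_x²`. -/
theorem sq_avg_le_avg_sq (a : Fin (n + 1) → ℝ) :
    ((∑ x, a x) / ((n : ℝ) + 1)) ^ 2 ≤ (∑ x, a x ^ 2) / ((n : ℝ) + 1) := by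
  have hn : (0 : ℝ) < (n : ℝ) + 1 := by positivity
  have h := sq_sum_le_card_mul_sum_sq (s := (Finset.univ : Finset (Fin (n + 1)))) (f := a)
  rw [Finset.card_univ, Fintype.card_fin] at h
  push_cast at h
  rw [div_pow, div_le_div_iff₀ (by positivity) hn]
  nlinarith [h]

/-- **THE RANDOM-SITE SCAN IS AN `L²(e^{−S})` CONTRACTION**: `∫ (Kf)² e^{−S} ≤ ∫ f² e^{−S}`
(Jensen over the site average, then row 2's `metroSite_contraction` site by site). -/
theorem metroScan_contraction {J : Fin (n + 1) → Fin (n + 1) → ℝ} {lam ε K : ℝ} (hε : 0 < ε)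
    (hS : ∀ φ : Fin (n + 1) → ℝ, ε * ∑ w, φ w ^ 2 - K ≤ latticePhi4Action J lam φ)
    {ρ : ℝ → ℝ} (hρ0 : ∀ u, 0 ≤ ρ u) (hρm : Measurable ρ) (hρi : Integrable ρ)
    (hρ1 : ∫ u, ρ u = 1) (hρs : ∀ u, ρ (-u) = ρ u) {f : (Fin (n + 1) → ℝ) → ℝ} (hf : BddObs f) :
    ∫ φ, metroScan J lam ρ f φ ^ 2 * gibbsWeight J lam φ ≤ ∫ φ, f φ ^ 2 * gibbsWeight J lam φ := by
  have hn : (0 : ℝ) < (n : ℝ) + 1 := by positivity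
  have hKf := bddObs_metroScan J lam hρ0 hρm hρi hρ1 hf
  have hMf : ∀ x, BddObs (metroSite J lam ρ x f) := fun x => bddObs_metroSite J lam hρ0 hρm hρi hρ1 x hf
  -- integrability of both sides of the pointwise Jensen bound
  have iL : Integrable (fun φ => metroScan J lam ρ f φ ^ 2 * gibbsWeight J lam φ) := by
    have := bddObs_integrable_mul_mul_gibbsWeight hε hS hKf hKf
    exact this.congr (Eventually.of_forall fun φ => by simp only [sq])
  have iMx : ∀ x, Integrable (fun φ => metroSite J lam ρ x f φ ^ 2 * gibbsWeight J lam φ) := by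
    intro x
    have := bddObs_integrable_mul_mul_gibbsWeight hε hS (hMf x) (hMf x)
    exact this.congr (Eventually.of_forall fun φ => by simp only [sq])
  have iR : Integrable (fun φ => (∑ x, metroSite J lam ρ x f φ ^ 2 * gibbsWeight J lam φ)
      / ((n : ℝ) + 1)) := (integrable_finsetSum Finset.univ fun x _ => iMx x).div_const _
  calc ∫ φ, metroScan J lam ρ f φ ^ 2 * gibbsWeight J lam φ
      ≤ ∫ φ, (∑ x, metroSite J lam ρ x f φ ^ 2 * gibbsWeight J lam φ) / ((n : ℝ) + 1) := by
        refine integral_mono iL iR fun φ => ?_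
        have hJ := sq_avg_le_avg_sq (fun x => metroSite J lam ρ x f φ)
        have hw := (gibbsWeight_pos J lam φ).le
        calc metroScan J lam ρ f φ ^ 2 * gibbsWeight J lam φ
            ≤ (∑ x, metroSite J lam ρ x f φ ^ 2) / ((n : ℝ) + 1) * gibbsWeight J lam φ :=
              mul_le_mul_of_nonneg_right hJ hw
          _ = (∑ x, metroSite J lam ρ x f φ ^ 2 * gibbsWeight J lam φ) / ((n : ℝ) + 1) := by
              rw [div_mul_eq_mul_div, Finset.sum_mul]
    _ = (∑ x, ∫ φ, metroSite J lam ρ x f φ ^ 2 * gibbsWeight J lam φ) / ((n : ℝ) + 1) := by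
        rw [integral_div, integral_finsetSum _ fun x _ => iMx x]
    _ ≤ (∑ _x : Fin (n + 1), ∫ φ, f φ ^ 2 * gibbsWeight J lam φ) / ((n : ℝ) + 1) := by
        refine div_le_div_of_nonneg_right (Finset.sum_le_sum fun x _ => ?_) hn.le
        obtain ⟨hfm, B, hfb⟩ := hf
        exact metroSite_contraction hε hS x hρ0 hρm hρi hρ1 hρs hfm hfb
    _ = ∫ φ, f φ ^ 2 * gibbsWeight J lam φ := by
        rw [Finset.sum_const, Finset.card_univ, Fintype.card_fin, nsmul_eq_mul]
        push_cast
        field_simp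

/-- **BOUNDED MOVES, one site**: if every proposal the step law can make at site `x` changes `g` by
at most `√D` in square (`ρ(t' − φ_x) ≠ 0 ⇒ (g(φ|φ_x:=t') − g φ)² ≤ D`), then the hit's carré du
champ at `φ` is at most `D`: `M_x[(g − g φ)²](φ) ≤ D`. -/
theorem metroSite_sq_dev_le (J : Fin (n + 1) → Fin (n + 1) → ℝ) (lam : ℝ) {ρ : ℝ → ℝ}
    (hρ0 : ∀ u, 0 ≤ ρ u) (hρi : Integrable ρ) (hρ1 : ∫ u, ρ u = 1) (x : Fin (n + 1))
    {g : (Fin (n + 1) → ℝ) → ℝ} {D : ℝ} (φ : Fin (n + 1) → ℝ)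
    (hmove : ∀ t', ρ (t' - φ x) ≠ 0 → (g (Function.update φ x t') - g φ) ^ 2 ≤ D) :
    metroSite J lam ρ x (fun ψ => (g ψ - g φ) ^ 2) φ ≤ D := by
  have hρt : Integrable (fun t' => ρ (t' - φ x)) := hρi.comp_sub_right (φ x)
  have hρt1 : ∫ t', ρ (t' - φ x) = 1 := by
    rw [integral_sub_right_eq_self (μ := (volume : Measure ℝ)) ρ (φ x), hρ1]
  unfold metroSite
  simp only [sub_self, zero_pow (two_ne_zero), mul_zero, add_zero]
  calc ∫ t', metroAccept J lam x φ t' * (g (Function.update φ x t') - g φ) ^ 2 * ρ (t' - φ x)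
      ≤ ∫ t', D * ρ (t' - φ x) := by
        refine integral_mono_of_nonneg (Eventually.of_forall fun t' => ?_) (hρt.const_mul D)
          (Eventually.of_forall fun t' => ?_)
        · obtain ⟨ha0, -⟩ := metroAccept_nonneg_le J lam x φ t'
          exact mul_nonneg (mul_nonneg ha0 (sq_nonneg _)) (hρ0 _)
        · obtain ⟨ha0, ha1⟩ := metroAccept_nonneg_le J lam x φ t'
          by_cases hz : ρ (t' - φ x) = 0
          · simp [hz]
          · have hD := hmove t' hz
            have : metroAccept J lam x φ t' * (g (Function.update φ x t') - g φ) ^ 2 ≤ D :=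
              calc metroAccept J lam x φ t' * (g (Function.update φ x t') - g φ) ^ 2
                  ≤ 1 * (g (Function.update φ x t') - g φ) ^ 2 :=
                    mul_le_mul_of_nonneg_right ha1 (sq_nonneg _)
                _ ≤ D := by rw [one_mul]; exact hD
            exact mul_le_mul_of_nonneg_right this (hρ0 _)
    _ = D := by rw [integral_const_mul, hρt1, mul_one]

/-- **BOUNDED MOVES, the scan**: under the same per-site move bound at every site, the scan's carré
du champ is at most `D` everywhere: `K[(g − g φ)²](φ) ≤ D`. -/
theorem metroScan_sq_dev_le (J : Fin (n + 1) → Fin (n + 1) → ℝ) (lam : ℝ) {ρ : ℝ → ℝ}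
    (hρ0 : ∀ u, 0 ≤ ρ u) (hρi : Integrable ρ) (hρ1 : ∫ u, ρ u = 1)
    {g : (Fin (n + 1) → ℝ) → ℝ} {D : ℝ} (φ : Fin (n + 1) → ℝ)
    (hmove : ∀ x t', ρ (t' - φ x) ≠ 0 → (g (Function.update φ x t') - g φ) ^ 2 ≤ D) :
    metroScan J lam ρ (fun ψ => (g ψ - g φ) ^ 2) φ ≤ D := by
  have hn : (0 : ℝ) < (n : ℝ) + 1 := by positivity
  unfold metroScan
  rw [div_le_iff₀ hn]
  calc ∑ x, metroSite J lam ρ x (fun ψ => (g ψ - g φ) ^ 2) φ ≤ ∑ _x : Fin (n + 1), D :=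
        Finset.sum_le_sum fun x _ => metroSite_sq_dev_le J lam hρ0 hρi hρ1 x φ (hmove x)
    _ = D * ((n : ℝ) + 1) := by
        rw [Finset.sum_const, Finset.card_univ, Fintype.card_fin, nsmul_eq_mul]
        push_cast
        ring

end Scan

end Summit.Ventures.LatticeQCDFlow.Exactness
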